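import Summits.RiemannHypothesis.RiemannHypothesis.Theorems.WeilTwoPrimeDeflM78YBase
import Summits.RiemannHypothesis.RiemannHypothesis.Theorems.WeilTwoPrimeDeflM78YDataR
import Literature.NumberTheory.LFunctions.WeilTwoPrimeCellsT120
import Literature.NumberTheory.LFunctions.WeilTwoPrimeCertificateDeflated
import HarnessLib

/-!
# Deflated two-prime certificate M78Y: the certificate `weilCertDeflM78Y : WeilCert23` and its augmented coefficient matrix

`weilCertDeflM78Y` = base `weilCertDeflM78YBase` + `j = 5` + `pnu = 64` + the cells `weilTwoPrimeCellsT120` + support `b = 39/50` + the table `weilCertDeflM78YNu`; penalty data `weilCertDeflM78YR`; `weilCertDeflM78YP = P_r + Σ μ ĉ ĉᵀ`. [cite: Yoshida1992, §6, Thm 1 p. 310] Data only.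
-/

noncomputable section

namespace Summit.RiemannHypothesis.RiemannHypothesis.Theorems.EvenWinsBeyondArch

open Literature.NumberTheory.LFunctions

/-- **The deflated two-prime certificate M78Y** (`a₀ = b = 39/50`, `N = 255`, `T = 120`, `β₂₃ = 16/25`, k_odd = 6). [folklore] -/
def weilCertDeflM78Y : WeilCert23 := ⟨weilCertDeflM78YBase, 5, 64, weilTwoPrimeCellsT120, 39/50, weilCertDeflM78YNu⟩

/-- The base of `weilCertDeflM78Y` is `weilCertDeflM78YBase` (definitional). [folklore] -/
theorem weilCertDeflM78Y_base : weilCertDeflM78Y.base = weilCertDeflM78YBase := rfl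

/-- The table of `weilCertDeflM78Y` is `weilCertDeflM78YNu` (definitional). [folklore] -/
theorem weilCertDeflM78Y_nuTab : weilCertDeflM78Y.nuTab = weilCertDeflM78YNu := rfl

/-- The augmented coefficient matrix `P_r + Σ μ ĉ ĉᵀ` of certificate M78Y. [folklore] -/
def weilCertDeflM78YP (k l : ℕ) : ℚ := weilCertDeflM78YBase.prQ weilCertDeflM78YNu k l + rankOneQ weilCertDeflM78YR k l

/-- `weilCertDeflM78YP` is the augmented matrix of the certificate (definitional). [folklore] -/
theorem weilCertDeflM78YP_eq : weilCertDeflM78YP = fun k l ↦ weilCertDeflM78Y.base.prQ weilCertDeflM78Y.nuTab k l + rankOneQ weilCertDeflM78YR k l := rfl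

end Summit.RiemannHypothesis.RiemannHypothesis.Theorems.EvenWinsBeyondArch
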